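import Summits.Ventures.PercRepro.S1SevenFiveFourThree

/-!
# PercRepro — THE `(3, 4)` SPLIT AT `(7, 4)`: A SIMPLE COLOOP-FREE RANK-3 PART ON 6 POINTS ⊕ A SIMPLE COLOOP-FREE
RANK-4 PART ON 6 POINTS (p2, gen 28; SUBCLAIM-S1 §6.10 (xvii)(m))

The shape where the crude bounds lose and the EXACT spanning count wins. With `s` the number of spanning `4`-sets
of the rank-`4` part `N` on `6` points: `N_N(4, 2) ≤ s`, `f_N(4) ≥ 7 + s` (the ground set, the six `5`-sets, the
spanning `4`-sets), `f_N(3) + f_N(4) ≥ 37` (the `3`-sets that are not rank-`2` triples, all `4`-sets, all `5`-sets,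
`E`), `f_N(2) + f_N(3) ≥ 50 − s` (the pairs, the `3`-sets, the non-spanning `4`-sets). Then
`#U ≤ 25 s + 120`, `#Y ≥ 6 f_N(4) + 15 (f_N(3) + f_N(4)) + 23 (f_N(2) + f_N(3)) ≥ 1747 − 17 s`, and
`Φ(7, 4) · #U ≤ 70 s + 336 ≤ 1747 − 17 s` for `s ≤ 15`. Nothing is claimed about any cell.

* `profileSet_four_two_subset_spanning_four`, `ncard_rankSet_four_ge_rank_four_six`,
  `ncard_rankSet_three_add_four_ge_rank_four_six`, `ncard_rankSet_two_add_three_add_spanning_ge_rank_four_six`;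
* `c025_seven_four_disjointSum_three_four`.
Axioms: standard.
-/

open scoped Matroid

namespace PercRepro

namespace S1

open Set

variable {α : Type}

section RankFourOnSix

variable {N : Matroid α} [N.Finite]

/-- On `6` points of rank `4`, a spanning set whose complement has rank `2` is a spanning `4`-set. -/
theorem profileSet_four_two_subset_spanning_four (hE : N.E.ncard = 6) :
    profileSet N 4 2 ⊆ {A : Set α | A ⊆ N.E ∧ A.ncard = 4 ∧ N.eRk A = ((4 : ℕ) : ℕ∞)} := by
  rintro A ⟨hAE, hA4, hAc⟩
  have hAfin : A.Finite := N.ground_finite.subset hAE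
  have h1 : ((4 : ℕ) : ℕ∞) ≤ (A.ncard : ℕ∞) := by
    rw [← hA4, hAfin.cast_ncard_eq]; exact N.eRk_le_encard A
  have h2 : ((2 : ℕ) : ℕ∞) ≤ ((N.E \ A).ncard : ℕ∞) := by
    rw [← hAc, (N.ground_finite.subset sdiff_subset).cast_ncard_eq]; exact N.eRk_le_encard _
  have h3 : A.ncard + (N.E \ A).ncard = N.E.ncard := by
    rw [← ncard_union_eq disjoint_sdiff_right hAfin (N.ground_finite.subset sdiff_subset), union_sdiff_cancel hAE]
  have h1' : 4 ≤ A.ncard := by exact_mod_cast h1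
  have h2' : 2 ≤ (N.E \ A).ncard := by exact_mod_cast h2
  exact ⟨hAE, by omega, hA4⟩

/-- In a coloop-free matroid of rank `4` on `6` points every `4`-set has rank `3` or `4` and every `5`-set rank `4`. -/
theorem eRk_of_ncard_four_or_five (hN : N.eRank = ((4 : ℕ) : ℕ∞)) (hE : N.E.ncard = 6) (hcol : N.coloops = ∅)
    {X : Set α} (hX : X ⊆ N.E) :
    (X.ncard = 4 → N.eRk X = ((3 : ℕ) : ℕ∞) ∨ N.eRk X = ((4 : ℕ) : ℕ∞)) ∧
      (X.ncard = 5 → N.eRk X = ((4 : ℕ) : ℕ∞)) := by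
  have hhi : N.eRk X ≤ N.eRank := N.eRk_le_eRank X
  rw [hN] at hhi
  obtain ⟨n, hn⟩ := ENat.ne_top_iff_exists.mp (ne_top_of_le_ne_top (by decide) hhi)
  rw [← hn] at hhi ⊢
  have hhi' : n ≤ 4 := by exact_mod_cast hhi
  have hmiss : n < 4 → 4 - n + 1 ≤ (N.E \ X).ncard := fun h =>
    sub_add_one_le_ncard_ground_sdiff_of_coloops N hN hcol hX hn.symm h
  have hc : (N.E \ X).ncard = 6 - X.ncard := by rw [ncard_sdiff' hX N.ground_finite, hE]
  constructor
  · intro h4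
    rw [h4] at hc
    rcases Nat.lt_or_ge n 4 with h | h
    · have := hmiss h
      rw [hc] at this
      have hn3 : n = 3 := by omega
      left; rw [hn3]
    · have hn4 : n = 4 := by omega
      right; rw [hn4]
  · intro h5
    rw [h5] at hc
    rcases Nat.lt_or_ge n 4 with h | h
    · have := hmiss h
      rw [hc] at this
      omega
    · have hn4 : n = 4 := by omega
      rw [hn4]

/-- `f(4) ≥ 7 + s`: the ground set, the six `5`-sets and the `s` spanning `4`-sets. -/
theorem ncard_rankSet_four_ge_rank_four_six (hN : N.eRank = ((4 : ℕ) : ℕ∞)) (hE : N.E.ncard = 6)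
    (hcol : N.coloops = ∅) :
    7 + {A : Set α | A ⊆ N.E ∧ A.ncard = 4 ∧ N.eRk A = ((4 : ℕ) : ℕ∞)}.ncard ≤ (rankSet N 4).ncard := by
  have hf : ∀ k : ℕ, {A : Set α | A ⊆ N.E ∧ A.ncard = k}.Finite := fun k =>
    N.ground_finite.finite_subsets.subset (fun _ hA => hA.1)
  have hS : {A : Set α | A ⊆ N.E ∧ A.ncard = 4 ∧ N.eRk A = ((4 : ℕ) : ℕ∞)}.Finite :=
    N.ground_finite.finite_subsets.subset (fun _ hA => hA.1)
  have hsub : {N.E} ∪ {A : Set α | A ⊆ N.E ∧ A.ncard = 5} ∪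
      {A : Set α | A ⊆ N.E ∧ A.ncard = 4 ∧ N.eRk A = ((4 : ℕ) : ℕ∞)} ⊆ rankSet N 4 := by
    rintro A ((hA | ⟨hAE, h5⟩) | ⟨hAE, -, h4⟩)
    · rw [mem_singleton_iff] at hA
      subst hA
      exact ⟨subset_rfl, by rw [N.eRk_ground, hN]⟩
    · exact ⟨hAE, (eRk_of_ncard_four_or_five hN hE hcol hAE).2 h5⟩
    · exact ⟨hAE, h4⟩
  have h := ncard_le_ncard hsub (rankSet_finite N 4)
  rw [ncard_union_eq (by
        rw [Set.disjoint_left]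
        rintro A (hA | ⟨-, h5⟩) ⟨-, h4, -⟩
        · rw [mem_singleton_iff] at hA; subst hA; omega
        · omega) ((finite_singleton _).union (hf 5)) hS,
    ncard_union_eq (by
        rw [Set.disjoint_left]
        rintro A hA ⟨-, h5⟩
        rw [mem_singleton_iff] at hA; subst hA; omega) (finite_singleton _) (hf 5),
    ncard_singleton, ncard_setOf_subset_ncard_eq N.ground_finite 5, hE, show Nat.choose 6 5 = 6 by decide] at h
  omega

/-- `f(3) + f(4) ≥ 37`: the `3`-sets that are not rank-`2` triples (at least `15`), the `15` four-sets, the six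
`5`-sets and the ground set. -/
theorem ncard_rankSet_three_add_four_ge_rank_four_six (hN : N.eRank = ((4 : ℕ) : ℕ∞)) (hE : N.E.ncard = 6)
    (hcol : N.coloops = ∅) (hpairs : ∀ e ∈ N.E, ∀ f ∈ N.E, e ≠ f → N.eRk {e, f} = 2) :
    37 ≤ (rankSet N 3).ncard + (rankSet N 4).ncard := by
  have hf : ∀ k : ℕ, {A : Set α | A ⊆ N.E ∧ A.ncard = k}.Finite := fun k =>
    N.ground_finite.finite_subsets.subset (fun _ hA => hA.1)
  have hTsub : rankTwoTriples N ⊆ {A : Set α | A ⊆ N.E ∧ A.ncard = 3} := fun T hT => ⟨hT.1, hT.2.1⟩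
  have hcl : ∀ x ∈ N.E, ∀ y ∈ N.E, x ≠ y → (N.closure {x, y}).ncard ≤ 1 + 2 := by
    intro x hx y hy hxy
    have := ncard_closure_pair_le_of_coloops' N hN (by norm_num) hcol hpairs hx hy hxy
    rw [hE] at this
    omega
  have ht := three_mul_ncard_rankTwoTriples_le_of_closure N hpairs hcl
  rw [hE, show Nat.choose 6 2 = 15 by decide] at ht
  have hsub : ({A : Set α | A ⊆ N.E ∧ A.ncard = 3} \ rankTwoTriples N) ∪ {A : Set α | A ⊆ N.E ∧ A.ncard = 4} ∪
      {A : Set α | A ⊆ N.E ∧ A.ncard = 5} ∪ {N.E} ⊆ rankSet N 3 ∪ rankSet N 4 := by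
    rintro A (((⟨⟨hAE, hA3⟩, hAT⟩ | ⟨hAE, hA4⟩) | ⟨hAE, hA5⟩) | hA)
    · left
      refine ⟨hAE, ?_⟩
      have hhi : N.eRk A ≤ 3 := by
        have := N.eRk_le_encard A
        rwa [← (N.ground_finite.subset hAE).cast_ncard_eq, hA3] at this
      have hlo := two_le_eRk_of_two_le_ncard hpairs hAE (by omega)
      obtain ⟨n, hn⟩ := ENat.ne_top_iff_exists.mp (ne_top_of_le_ne_top (by decide) hhi)
      rw [← hn] at hlo hhi ⊢
      have hlo' : 2 ≤ n := by exact_mod_cast hlo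
      have hhi' : n ≤ 3 := by exact_mod_cast hhi
      rcases Nat.lt_or_ge n 3 with h | h
      · exfalso
        apply hAT
        refine ⟨hAE, hA3, ?_⟩
        rw [← hn]
        have : n = 2 := by omega
        rw [this]; rfl
      · have : n = 3 := by omega
        rw [this]
    · rcases (eRk_of_ncard_four_or_five hN hE hcol hAE).1 hA4 with h | h
      · exact Or.inl ⟨hAE, h⟩
      · exact Or.inr ⟨hAE, h⟩
    · exact Or.inr ⟨hAE, (eRk_of_ncard_four_or_five hN hE hcol hAE).2 hA5⟩
    · rw [mem_singleton_iff] at hA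
      subst hA
      exact Or.inr ⟨subset_rfl, by rw [N.eRk_ground, hN]⟩
  have h := ncard_le_ncard hsub ((rankSet_finite N 3).union (rankSet_finite N 4))
  rw [ncard_union_eq (rankSet_disjoint_of_ne N (by norm_num)) (rankSet_finite N 3) (rankSet_finite N 4),
    ncard_union_eq (by
        rw [Set.disjoint_left]
        rintro A ((⟨⟨-, h3⟩, -⟩ | ⟨-, h4⟩) | ⟨-, h5⟩) hA <;> rw [mem_singleton_iff] at hA <;> subst hA <;> omega)
      ((((hf 3).subset sdiff_subset).union (hf 4)).union (hf 5)) (finite_singleton _),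
    ncard_union_eq (by
        rw [Set.disjoint_left]
        rintro A (⟨⟨-, h3⟩, -⟩ | ⟨-, h4⟩) ⟨-, h5⟩ <;> omega)
      (((hf 3).subset sdiff_subset).union (hf 4)) (hf 5),
    ncard_union_eq (by
        rw [Set.disjoint_left]
        rintro A ⟨⟨-, h3⟩, -⟩ ⟨-, h4⟩; omega) ((hf 3).subset sdiff_subset) (hf 4),
    ncard_sdiff hTsub (rankTwoTriples_finite N), ncard_singleton,
    ncard_setOf_subset_ncard_eq N.ground_finite 3, ncard_setOf_subset_ncard_eq N.ground_finite 4,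
    ncard_setOf_subset_ncard_eq N.ground_finite 5, hE] at h
  have c3 : Nat.choose 6 3 = 20 := by decide
  have c4 : Nat.choose 6 4 = 15 := by decide
  have c5 : Nat.choose 6 5 = 6 := by decide
  have hT5 : (rankTwoTriples N).ncard ≤ 5 := by omega
  have hT20 : (rankTwoTriples N).ncard ≤ Nat.choose 6 3 := by rw [c3]; omega
  omega

/-- `f(2) + f(3) + s ≥ 50`: the `15` pairs, the `20` three-sets and the `15 − s` non-spanning `4`-sets all have
rank `2` or `3`. -/
theorem ncard_rankSet_two_add_three_add_spanning_ge_rank_four_six (hN : N.eRank = ((4 : ℕ) : ℕ∞))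
    (hE : N.E.ncard = 6) (hcol : N.coloops = ∅) (hpairs : ∀ e ∈ N.E, ∀ f ∈ N.E, e ≠ f → N.eRk {e, f} = 2) :
    50 ≤ (rankSet N 2).ncard + (rankSet N 3).ncard +
      {A : Set α | A ⊆ N.E ∧ A.ncard = 4 ∧ N.eRk A = ((4 : ℕ) : ℕ∞)}.ncard := by
  have hf : ∀ k : ℕ, {A : Set α | A ⊆ N.E ∧ A.ncard = k}.Finite := fun k =>
    N.ground_finite.finite_subsets.subset (fun _ hA => hA.1)
  have hSsub : {A : Set α | A ⊆ N.E ∧ A.ncard = 4 ∧ N.eRk A = ((4 : ℕ) : ℕ∞)} ⊆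
      {A : Set α | A ⊆ N.E ∧ A.ncard = 4} := fun A hA => ⟨hA.1, hA.2.1⟩
  have hS : {A : Set α | A ⊆ N.E ∧ A.ncard = 4 ∧ N.eRk A = ((4 : ℕ) : ℕ∞)}.Finite := (hf 4).subset hSsub
  have hsub : {A : Set α | A ⊆ N.E ∧ A.ncard = 2} ∪ {A : Set α | A ⊆ N.E ∧ A.ncard = 3} ∪
      ({A : Set α | A ⊆ N.E ∧ A.ncard = 4} \ {A : Set α | A ⊆ N.E ∧ A.ncard = 4 ∧ N.eRk A = ((4 : ℕ) : ℕ∞)}) ⊆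
      rankSet N 2 ∪ rankSet N 3 := by
    rintro A ((⟨hAE, h2⟩ | ⟨hAE, h3⟩) | ⟨⟨hAE, h4⟩, hAS⟩)
    · left
      refine ⟨hAE, ?_⟩
      obtain ⟨x, y, hxy, rfl⟩ := ncard_eq_two.mp h2
      rw [hpairs x (hAE (by simp)) y (hAE (by simp)) hxy]; rfl
    · have hhi : N.eRk A ≤ 3 := by
        have := N.eRk_le_encard A
        rwa [← (N.ground_finite.subset hAE).cast_ncard_eq, h3] at this
      have hlo := two_le_eRk_of_two_le_ncard hpairs hAE (by omega)
      obtain ⟨n, hn⟩ := ENat.ne_top_iff_exists.mp (ne_top_of_le_ne_top (by decide) hhi)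
      rw [← hn] at hlo hhi
      have hlo' : 2 ≤ n := by exact_mod_cast hlo
      have hhi' : n ≤ 3 := by exact_mod_cast hhi
      have hmem : ∀ k, n = k → A ∈ rankSet N k := fun k hk => ⟨hAE, by rw [← hn, hk]⟩
      rcases Nat.lt_or_ge n 3 with h | h
      · exact Or.inl (hmem 2 (by omega))
      · exact Or.inr (hmem 3 (by omega))
    · rcases (eRk_of_ncard_four_or_five hN hE hcol hAE).1 h4 with h | h
      · exact Or.inr ⟨hAE, h⟩
      · exact absurd ⟨hAE, h4, h⟩ hAS
  have h := ncard_le_ncard hsub ((rankSet_finite N 2).union (rankSet_finite N 3))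
  rw [ncard_union_eq (rankSet_disjoint_of_ne N (by norm_num)) (rankSet_finite N 2) (rankSet_finite N 3),
    ncard_union_eq (by
        rw [Set.disjoint_left]
        rintro A (⟨-, h2⟩ | ⟨-, h3⟩) ⟨⟨-, h4⟩, -⟩ <;> omega) ((hf 2).union (hf 3)) ((hf 4).subset sdiff_subset),
    ncard_union_eq (by rw [Set.disjoint_left]; rintro A ⟨-, h2⟩ ⟨-, h3⟩; omega) (hf 2) (hf 3),
    ncard_sdiff hSsub hS, ncard_setOf_subset_ncard_eq N.ground_finite 2, ncard_setOf_subset_ncard_eq N.ground_finite 3,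
    ncard_setOf_subset_ncard_eq N.ground_finite 4, hE] at h
  have c2 : Nat.choose 6 2 = 15 := by decide
  have c3 : Nat.choose 6 3 = 20 := by decide
  have c4 : Nat.choose 6 4 = 15 := by decide
  have hS15 : {A : Set α | A ⊆ N.E ∧ A.ncard = 4 ∧ N.eRk A = ((4 : ℕ) : ℕ∞)}.ncard ≤ Nat.choose 6 4 := by
    have := ncard_le_ncard hSsub (hf 4)
    rwa [ncard_setOf_subset_ncard_eq N.ground_finite 4, hE] at this
  omega

end RankFourOnSix

/-- The arithmetic of the `(3, 4)`-split consumer at `(7, 4)`. -/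
theorem consumer_arith_three_four_seven {u y s F2 F3 F4 : ℚ} (hU : u ≤ 25 * s + 120)
    (hY : 6 * F4 + 15 * (F3 + F4) + 23 * (F2 + F3) ≤ y) (h4 : 7 + s ≤ F4) (h34 : 37 ≤ F3 + F4)
    (h23 : 50 ≤ F2 + F3 + s) (hs : s ≤ 15) : 14 / 5 * u ≤ y := by
  linarith

/-- **The `(3, 4)`-split consumer at `(7, 4)`**: `M` coloop-free of rank `3` on `6` points and `N` coloop-free of
rank `4` on `6` points, both with all pairs of rank `2`. -/
theorem c025_seven_four_disjointSum_three_four (M N : Matroid α) [M.Finite] [N.Finite] (h : Disjoint M.E N.E)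
    (hM : M.eRank = ((3 : ℕ) : ℕ∞)) (hME : M.E.ncard = 6) (hcolM : M.coloops = ∅)
    (hpairsM : ∀ e ∈ M.E, ∀ f ∈ M.E, e ≠ f → M.eRk {e, f} = 2) (hN : N.eRank = ((4 : ℕ) : ℕ∞))
    (hNE : N.E.ncard = 6) (hcolN : N.coloops = ∅) (hpairsN : ∀ e ∈ N.E, ∀ f ∈ N.E, e ≠ f → N.eRk {e, f} = 2) :
    phiK 7 4 * ({A : Set α | A ⊆ (M.disjointSum N h).E ∧ (M.disjointSum N h).eRk A = ((7 : ℕ) : ℕ∞) ∧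
        (M.disjointSum N h).eRk ((M.disjointSum N h).E \ A) = ((4 : ℕ) : ℕ∞)}.ncard : ℚ) ≤
      ({A : Set α | A ⊆ (M.disjointSum N h).E ∧ ((4 : ℕ) : ℕ∞) < (M.disjointSum N h).eRk A ∧
        (M.disjointSum N h).eRk A < ((7 : ℕ) : ℕ∞)}.ncard : ℚ) := by
  have hSfin : {A : Set α | A ⊆ N.E ∧ A.ncard = 4 ∧ N.eRk A = ((4 : ℕ) : ℕ∞)}.Finite :=
    N.ground_finite.finite_subsets.subset (fun _ hA => hA.1)
  have hs15 : {A : Set α | A ⊆ N.E ∧ A.ncard = 4 ∧ N.eRk A = ((4 : ℕ) : ℕ∞)}.ncard ≤ 15 := by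
    have := ncard_le_ncard (show {A : Set α | A ⊆ N.E ∧ A.ncard = 4 ∧ N.eRk A = ((4 : ℕ) : ℕ∞)} ⊆
      {A : Set α | A ⊆ N.E ∧ A.ncard = 4} from fun A hA => ⟨hA.1, hA.2.1⟩)
      (N.ground_finite.finite_subsets.subset (fun _ hA => hA.1))
    rwa [ncard_setOf_subset_ncard_eq N.ground_finite 4, hNE, show Nat.choose 6 4 = 15 by decide] at this
  -- the `U`-side
  have hU : {A : Set α | A ⊆ (M.disjointSum N h).E ∧ (M.disjointSum N h).eRk A = ((7 : ℕ) : ℕ∞) ∧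
      (M.disjointSum N h).eRk ((M.disjointSum N h).E \ A) = ((4 : ℕ) : ℕ∞)}.ncard ≤
      25 * {A : Set α | A ⊆ N.E ∧ A.ncard = 4 ∧ N.eRk A = ((4 : ℕ) : ℕ∞)}.ncard + 120 := by
    rw [disjointSum_ncard_U_eq_finsum M N h 7 4, finsum_mem_coe_finset]
    rw [Finset.sum_eq_add_of_mem (3, 2) (3, 3) (by decide) (by decide) (by decide) ?_]
    · dsimp only
      show (profileSet M 3 2).ncard * (profileSet N 4 2).ncard + (profileSet M 3 3).ncard * (profileSet N 4 1).ncard ≤ _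
      have hT := three_mul_ncard_rankTwoTriples_le hM hcolM hpairsM hME
      have h32 := ncard_profileSet_three_two_le_add (M := M) hME
      have h32' : (profileSet M 3 2).ncard ≤ 25 := by omega
      have h33 := ncard_profileSet_le_choose_of_ncard_eq (N := M) (a := 3) (b := 3) hME
      rw [show Nat.choose (3 + 3) 3 = 20 by decide] at h33
      have g42 := ncard_le_ncard (profileSet_four_two_subset_spanning_four hNE) hSfin
      have g41 := ncard_profileSet_top_one_le_of_pairs' hpairsN 4
      rw [hNE] at g41
      calc (profileSet M 3 2).ncard * (profileSet N 4 2).ncard + (profileSet M 3 3).ncard * (profileSet N 4 1).ncard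
          ≤ 25 * {A : Set α | A ⊆ N.E ∧ A.ncard = 4 ∧ N.eRk A = ((4 : ℕ) : ℕ∞)}.ncard + 20 * 6 :=
            Nat.add_le_add (Nat.mul_le_mul h32' g42) (Nat.mul_le_mul h33 g41)
        _ = 25 * {A : Set α | A ⊆ N.E ∧ A.ncard = 4 ∧ N.eRk A = ((4 : ℕ) : ℕ∞)}.ncard + 120 := by ring
    · rintro ⟨a, b⟩ hmem ⟨hne1, hne2⟩
      rw [Finset.mem_product, Finset.mem_range, Finset.mem_range] at hmem
      dsimp only
      rcases Nat.lt_or_ge 3 a with ha | ha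
      · rw [profileSet_eq_empty_of_eRank_lt M hM ha b, ncard_empty, zero_mul]
      rcases Nat.lt_or_ge a 3 with ha' | ha'
      · have h7a : 4 < 7 - a := by omega
        rw [profileSet_eq_empty_of_eRank_lt N hN h7a (4 - b), ncard_empty, mul_zero]
      have ha3 : a = 3 := by omega
      subst ha3
      rw [show (7 : ℕ) - 3 = 4 from rfl]
      rcases Nat.lt_or_ge b 2 with hb | hb
      · have h6 : N.E.ncard < 4 + (4 - b) := by rw [hNE]; omega
        rw [profileSet_eq_empty_of_ncard_lt N h6, ncard_empty, mul_zero]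
      · have hb4 : b = 4 := by
          rcases Nat.lt_or_ge b 4 with hb4 | hb4
          · exfalso
            rcases Nat.lt_or_ge b 3 with hb3 | hb3
            · exact hne1 (by congr 1; omega)
            · exact hne2 (by congr 1; omega)
          · omega
        subst hb4
        rw [profileSet_eq_empty_of_eRank_lt_snd M hM (by norm_num) 3, ncard_empty, zero_mul]
  -- the `Y`-side
  have hY : 6 * (rankSet N 4).ncard + 15 * ((rankSet N 3).ncard + (rankSet N 4).ncard) +
      23 * ((rankSet N 2).ncard + (rankSet N 3).ncard) ≤
      {A : Set α | A ⊆ (M.disjointSum N h).E ∧ ((4 : ℕ) : ℕ∞) < (M.disjointSum N h).eRk A ∧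
        (M.disjointSum N h).eRk A < ((7 : ℕ) : ℕ∞)}.ncard := by
    rw [disjointSum_ncard_Y_eq_finsum M N h 7 4, finsum_mem_coe_finset]
    have hsub : ({(1, 4), (2, 3), (2, 4), (3, 2), (3, 3)} : Finset (ℕ × ℕ)) ⊆
        (Finset.range 7 ×ˢ Finset.range 7).filter (fun x : ℕ × ℕ => 4 < x.1 + x.2 ∧ x.1 + x.2 < 7) := by
      decide
    refine le_trans ?_ (Finset.sum_le_sum_of_subset hsub)
    rw [Finset.sum_insert (by decide), Finset.sum_insert (by decide), Finset.sum_insert (by decide),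
      Finset.sum_insert (by decide), Finset.sum_singleton]
    dsimp only
    have F3 := ncard_rankSet_three_ge_of_pairs hM hcolM hpairsM hME
    have F2 : 15 ≤ (rankSet M 2).ncard := by
      have := choose_le_ncard_rankSet_two_of_pairs hpairsM
      rwa [hME, show Nat.choose 6 2 = 15 by decide] at this
    have F1 : 6 ≤ (rankSet M 1).ncard := by
      have := ncard_le_ncard_rankSet_one_of_pairs hpairsM (by omega)
      rwa [hME] at this
    have e14 := Nat.mul_le_mul_right (rankSet N 4).ncard F1
    have e23 := Nat.mul_le_mul_right (rankSet N 3).ncard F2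
    have e24 := Nat.mul_le_mul_right (rankSet N 4).ncard F2
    have e32 := Nat.mul_le_mul_right (rankSet N 2).ncard F3
    have e33 := Nat.mul_le_mul_right (rankSet N 3).ncard F3
    linarith
  have h4 := ncard_rankSet_four_ge_rank_four_six hN hNE hcolN
  have h34 := ncard_rankSet_three_add_four_ge_rank_four_six hN hNE hcolN hpairsN
  have h23 := ncard_rankSet_two_add_three_add_spanning_ge_rank_four_six hN hNE hcolN hpairsN
  rw [phiK_seven_four]
  have hU' : (({A : Set α | A ⊆ (M.disjointSum N h).E ∧ (M.disjointSum N h).eRk A = ((7 : ℕ) : ℕ∞) ∧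
      (M.disjointSum N h).eRk ((M.disjointSum N h).E \ A) = ((4 : ℕ) : ℕ∞)}.ncard : ℕ) : ℚ) ≤
      25 * ({A : Set α | A ⊆ N.E ∧ A.ncard = 4 ∧ N.eRk A = ((4 : ℕ) : ℕ∞)}.ncard : ℚ) + 120 := by
    exact_mod_cast hU
  have hY' : 6 * ((rankSet N 4).ncard : ℚ) + 15 * (((rankSet N 3).ncard : ℚ) + ((rankSet N 4).ncard : ℚ)) +
      23 * (((rankSet N 2).ncard : ℚ) + ((rankSet N 3).ncard : ℚ)) ≤
      (({A : Set α | A ⊆ (M.disjointSum N h).E ∧ ((4 : ℕ) : ℕ∞) < (M.disjointSum N h).eRk A ∧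
        (M.disjointSum N h).eRk A < ((7 : ℕ) : ℕ∞)}.ncard : ℕ) : ℚ) := by
    exact_mod_cast hY
  have h4' : (7 : ℚ) + ({A : Set α | A ⊆ N.E ∧ A.ncard = 4 ∧ N.eRk A = ((4 : ℕ) : ℕ∞)}.ncard : ℚ) ≤
      ((rankSet N 4).ncard : ℚ) := by exact_mod_cast h4
  have h34' : (37 : ℚ) ≤ ((rankSet N 3).ncard : ℚ) + ((rankSet N 4).ncard : ℚ) := by exact_mod_cast h34
  have h23' : (50 : ℚ) ≤ ((rankSet N 2).ncard : ℚ) + ((rankSet N 3).ncard : ℚ) +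
      ({A : Set α | A ⊆ N.E ∧ A.ncard = 4 ∧ N.eRk A = ((4 : ℕ) : ℕ∞)}.ncard : ℚ) := by exact_mod_cast h23
  have hs15' : ({A : Set α | A ⊆ N.E ∧ A.ncard = 4 ∧ N.eRk A = ((4 : ℕ) : ℕ∞)}.ncard : ℚ) ≤ 15 := by
    exact_mod_cast hs15
  exact consumer_arith_three_four_seven hU' hY' h4' h34' h23' hs15'

end S1

end PercRepro
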